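import Summits.CriticalPhenomena.PercolationContinuityZ3.Theorems.Transplant.FKConnectivityAllQApexTools
import HarnessLib

/-!
# Connectivity correlation inequalities for `φ_{w,q}`, every `q > 0` — file 9b: apex elimination, THE THREE APEX IDENTITIES
# (pendant contraction, `S_w(F)`, `S_w(J_b ∩ F ∩ K')`, `S_w(J_a ∩ J_b ∩ F)` in terms of the apex-deleted vector)

Support file (`--supports stmt-CriticalPhenomena-4575`), FK sub-lane `prim-bschramm-fk-1` (gen 5) of the post-continuity
programme; builds on p205010 (kernel theorem, internal audit signed; external expert review pending).  No definitions, no named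
facts, no sorries; standard axioms.

THE ARGUMENT (files `…ApexTools`, `…ApexMass`, `…ApexCases`, `…ApexStep`, `…TwoTree`).  Wagner (Ann. Comb. 2008, Ex. 5.1 +
Thm. 5.8(d) + §5.3) proves that the random-cluster (Potts) model with `0 < q ≤ 1` is Rayleigh — edge-negatively associated,
`φ(J_e ∩ J_f) ≤ φ(J_e)φ(J_f)` (Grimmett 2006 §3.9 (3.94)) — on every series–parallel graph, by induction over two-sums.  We prove the
graph case by APEX ELIMINATION over 2-trees (whose subgraphs are exactly the series–parallel = `K₄`-minor-free graphs): a 2-tree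
is `{uv}` or `T ∪ {ux, xv}` with `uv ∈ T` and `x` fresh; for a weight vector `w` supported in `T ∪ {ux, xv}` write `a = ux`,
`b = xv`, `g = uv`, `w° = w[a↦0][b↦0]` and `K' = {u ↔ v avoiding a, b}`.  Three exact identities for events `F` insensitive to
`a, b` (file `…ApexMass`): `S_w(F) = ((1−p_a)+p_a q⁻¹)((1−p_b)+p_b q⁻¹)·S°(F) − p_a p_b q⁻¹(q⁻¹−1)·S°(F ∩ K')`,
`S_w(J_b ∩ F ∩ K') = p_b q⁻¹·S°(F ∩ K')`, `S_w(J_a ∩ J_b ∩ F) = p_a p_b (q⁻¹ S°(F) + (q⁻¹−1)q⁻¹ S°(F ∩ K'ᶜ))`.  With fk-2's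
master identity (`negCorr_defect_eq`: `Cov(J_e, J_f) ≤ 0 ⟺` opening `f` does not lower `φ_{w[e↦0]}(x ↔ y)`, `e = xy`) every pair
reduces to EC⁺ for `u ↔ v` one level down, i.e. to negative association on `T` (file `…ApexCases`): `(a, f)`:
`φ_{w[a↦0][f↦s]}(u ↔ x) = θ·φ_{w°[f↦s]}(u ↔ v)`; `(g, f)`: `φ_{w[g↦0][f↦s]}(u ↔ v)` is an increasing Möbius function of
`φ_{w°[g↦0][f↦s]}(u ↔ v)`; `(a, b)`, `(a, g)`: unconditional; and pairs `e, f ⊆ T ∖ g` are MARGINALISED (file `…ApexStep`):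
`S_w(E) = α·S_{w°[g↦c]}(E)` for `E ∈ {J_e ∩ J_f, J_e, J_f, Ω}` with `α = (1−p_a)(1−p_b) + (p_a+p_b−p_ap_b)q⁻¹` and
`α c = α p_g + (1−p_g)p_a p_b q⁻¹` (the path `u–x–v` is a pair `uv` in parallel with `g`).

THIS FILE: the pendant step (`sum_pendant_update_one`: with `a` dead, contracting `b` costs exactly `q⁻¹`), the three apex identities
`apex_mass`, `apex_mass_b_inter`, `apex_mass_ab_inter`, the measure/mass conversion for negative association
(`negCorr_real_iff_mass`), its trivial cases (dead pair, `q = 1`) and the LOCAL criterion `negCorr_of_edgeConnMono_at`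
(EC⁺ at one state ⇒ negative association of one pair of pairs; the master identity of `…AllQEdgeToggle` read backwards).
[cite: Wagner2006, Ex. 5.1, Thm. 5.8(d), §5.3] [cite: Grimmett2006, §3.9 eq. (3.94) (pp. 63–64); §1.4 eq. (1.20) (p. 15); Thm. (3.1)(a) (p. 37)]
-/

noncomputable section

namespace Summit.CriticalPhenomena.PercolationContinuityZ3.Theorems

namespace FK

open MeasureTheory Set Literature.Probability.LatticeModels Literature.Probability.Percolation
open Literature.Probability.Percolation.DecisionTree (ind ind_of_mem ind_of_not_mem ind_nonneg)
open Literature.Probability.Percolation.TwoAvoidanceSets (ind_mul_ind)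
open scoped Classical symmDiff

variable {V : Type*} [Fintype V]

/-! ### The pendant step at `b = s(x,v)` when `a = s(u,x)` is dead -/

/-- **Pendant contraction**: if every live pair at `x` contains `u` or `v` and `a = s(u,x)` has parameter `0`, then for every
event `F` insensitive to `b = s(x,v)`, `S_{w[b↦1]}(F) = q⁻¹·S_{w[b↦0]}(F)` (opening the pendant pair always merges the otherwise
isolated vertex `x`). [cite: Grimmett2006, Thm. (3.1)(a) (p. 37); §1.4 eq. (1.20) (p. 15)] -/
theorem sum_pendant_update_one (w : Sym2 V → unitInterval) {q : ℝ} (hq : q ≠ 0) {u v x : V} (hxu : x ≠ u) (hxv : x ≠ v)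
    (huv : u ≠ v) (hw : ∀ e : Sym2 V, x ∈ e → ((w e : unitInterval) : ℝ) ≠ 0 → u ∈ e ∨ v ∈ e)
    (ha : ((w s(u, x) : unitInterval) : ℝ) = 0) (F : Set (BondConfig V))
    (hF : ∀ ω : BondConfig V, ω ∆ {s(x, v)} ∈ F ↔ ω ∈ F) :
    ∑ ω : BondConfig V, rcWeightW (Function.update w s(x, v) 1) q ∅ ω * ind F ω =
      q⁻¹ * ∑ ω : BondConfig V, rcWeightW (Function.update w s(x, v) 0) q ∅ ω * ind F ω := by
  rw [sum_rcWeightW_update_one_eq_toggle w hq x v F hF]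
  have hab := apex_pairs_ne hxu huv
  have hw0 := apex_hyp_update hw s(x, v) (fun _ => Or.inr (Sym2.mem_mk_right x v)) 0
  have ha0 : ((Function.update w s(x, v) 0 s(u, x) : unitInterval) : ℝ) = 0 := by
    rw [Function.update_of_ne hab]; exact ha
  have hb0 : ((Function.update w s(x, v) 0 s(x, v) : unitInterval) : ℝ) = 0 := by simp
  have hfull : ∑ ω : BondConfig V, rcWeightW (Function.update w s(x, v) 0) q ∅ ω *
      ind (F ∩ (openConn x v : Set (BondConfig V))ᶜ) ω =
      ∑ ω : BondConfig V, rcWeightW (Function.update w s(x, v) 0) q ∅ ω * ind F ω := by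
    refine sum_rcWeightW_ind_congr_ae _ q fun ω hω => ?_
    have hiso := isolated_of_rcWeightW_ne_zero _ q hxu hxv hw0 ha0 hb0 hω
    constructor
    · exact fun h => h.1
    · exact fun h => ⟨h, not_reachable_of_isolated hiso hxv.symm⟩
  rw [hfull]
  ring

/-- **Pendant opening**: under the same hypotheses, `S_w(J_b ∩ E) = (w b)·q⁻¹·S_{w[b↦0]}(E)` for `E` insensitive to `b`.
[cite: Grimmett2006, Thm. (3.1)(a) (p. 37); §1.4 eq. (1.20) (p. 15)] -/
theorem sum_pendant_openPair (w : Sym2 V → unitInterval) {q : ℝ} (hq : q ≠ 0) {u v x : V} (hxu : x ≠ u) (hxv : x ≠ v)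
    (huv : u ≠ v) (hw : ∀ e : Sym2 V, x ∈ e → ((w e : unitInterval) : ℝ) ≠ 0 → u ∈ e ∨ v ∈ e)
    (ha : ((w s(u, x) : unitInterval) : ℝ) = 0) (E : Set (BondConfig V))
    (hE : ∀ ω : BondConfig V, ω ∆ {s(x, v)} ∈ E ↔ ω ∈ E) :
    ∑ ω : BondConfig V, rcWeightW w q ∅ ω * ind ({ω | s(x, v) ∈ ω} ∩ E) ω =
      ((w s(x, v) : unitInterval) : ℝ) * q⁻¹ * ∑ ω : BondConfig V, rcWeightW (Function.update w s(x, v) 0) q ∅ ω * ind E ω := by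
  rw [sum_rcWeightW_ind_inter_openPair w q s(x, v) E, sum_pendant_update_one w hq hxu hxv huv hw ha E hE]
  ring

/-- **Pendant partition function**: `Z_w = ((1 − w b) + (w b)·q⁻¹)·Z_{w[b↦0]}`. [cite: Grimmett2006, Thm. (3.1)(a) (p. 37)] -/
theorem sum_pendant_affine (w : Sym2 V → unitInterval) {q : ℝ} (hq : q ≠ 0) {u v x : V} (hxu : x ≠ u) (hxv : x ≠ v)
    (huv : u ≠ v) (hw : ∀ e : Sym2 V, x ∈ e → ((w e : unitInterval) : ℝ) ≠ 0 → u ∈ e ∨ v ∈ e)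
    (ha : ((w s(u, x) : unitInterval) : ℝ) = 0) (E : Set (BondConfig V))
    (hE : ∀ ω : BondConfig V, ω ∆ {s(x, v)} ∈ E ↔ ω ∈ E) :
    ∑ ω : BondConfig V, rcWeightW w q ∅ ω * ind E ω =
      ((1 - ((w s(x, v) : unitInterval) : ℝ)) + ((w s(x, v) : unitInterval) : ℝ) * q⁻¹) *
        ∑ ω : BondConfig V, rcWeightW (Function.update w s(x, v) 0) q ∅ ω * ind E ω := by
  rw [sum_rcWeightW_ind_affine w q s(x, v) E, sum_pendant_update_one w hq hxu hxv huv hw ha E hE]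
  ring


/-! ### Insensitivity of the apex-avoiding connection event -/

omit [Fintype V] in
/-- `K' = {u ↔ v avoiding the apex pairs}` is insensitive to each apex pair. [folklore] -/
theorem apexAvoid_insens (u v x : V) {e : Sym2 V} (he : e = s(u, x) ∨ e = s(x, v)) (ω : BondConfig V) :
    ω ∆ {e} ∈ {ω : BondConfig V | ω \ {s(u, x), s(x, v)} ∈ (openConn u v : Set (BondConfig V))} ↔
      ω ∈ {ω : BondConfig V | ω \ {s(u, x), s(x, v)} ∈ (openConn u v : Set (BondConfig V))} := by
  simp only [Set.mem_setOf_eq]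
  rw [symmDiff_apex_diff ω u v x he]

omit [Fintype V] in
/-- The complement of `K'` is insensitive to each apex pair. [folklore] -/
theorem apexAvoid_compl_insens (u v x : V) {e : Sym2 V} (he : e = s(u, x) ∨ e = s(x, v)) (ω : BondConfig V) :
    ω ∆ {e} ∈ {ω : BondConfig V | ω \ {s(u, x), s(x, v)} ∈ (openConn u v : Set (BondConfig V))}ᶜ ↔
      ω ∈ {ω : BondConfig V | ω \ {s(u, x), s(x, v)} ∈ (openConn u v : Set (BondConfig V))}ᶜ := by
  rw [Set.mem_compl_iff, Set.mem_compl_iff, apexAvoid_insens u v x he]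

omit [Fintype V] in
/-- Intersections of insensitive events are insensitive. [folklore] -/
theorem inter_insens {e : Sym2 V} {A B : Set (BondConfig V)} (hA : ∀ ω : BondConfig V, ω ∆ {e} ∈ A ↔ ω ∈ A)
    (hB : ∀ ω : BondConfig V, ω ∆ {e} ∈ B ↔ ω ∈ B) (ω : BondConfig V) : ω ∆ {e} ∈ A ∩ B ↔ ω ∈ A ∩ B := by
  rw [Set.mem_inter_iff, Set.mem_inter_iff, hA, hB]

/-! ### The three apex identities -/

/-- **Apex identity 2**: `S_w(J_b ∩ F ∩ K') = (w b)·q⁻¹·S_{w°}(F ∩ K')` for `F` insensitive to the apex pairs, where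
`w° = w[a↦0][b↦0]` and `K' = {u ↔ v avoiding the apex pairs}` (given `b` open and `K'`, the pair `a` closes a cycle).
[cite: Grimmett2006, Thm. (3.1)(a) (p. 37); §1.4 eq. (1.20) (p. 15)] -/
theorem apex_mass_b_inter (w : Sym2 V → unitInterval) {q : ℝ} (hq : q ≠ 0) {u v x : V} (hxu : x ≠ u) (hxv : x ≠ v)
    (huv : u ≠ v) (hw : ∀ e : Sym2 V, x ∈ e → ((w e : unitInterval) : ℝ) ≠ 0 → u ∈ e ∨ v ∈ e)
    (F : Set (BondConfig V)) (hFa : ∀ ω : BondConfig V, ω ∆ {s(u, x)} ∈ F ↔ ω ∈ F)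
    (hFb : ∀ ω : BondConfig V, ω ∆ {s(x, v)} ∈ F ↔ ω ∈ F) :
    ∑ ω : BondConfig V, rcWeightW w q ∅ ω *
        ind ({ω | s(x, v) ∈ ω} ∩ (F ∩ {ω : BondConfig V | ω \ {s(u, x), s(x, v)} ∈ (openConn u v : Set (BondConfig V))})) ω =
      ((w s(x, v) : unitInterval) : ℝ) * q⁻¹ *
        ∑ ω : BondConfig V, rcWeightW (Function.update (Function.update w s(u, x) 0) s(x, v) 0) q ∅ ω *
          ind (F ∩ {ω : BondConfig V | ω \ {s(u, x), s(x, v)} ∈ (openConn u v : Set (BondConfig V))}) ω := by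
  have hab := apex_pairs_ne hxu huv
  set K : Set (BondConfig V) := {ω : BondConfig V | ω \ {s(u, x), s(x, v)} ∈ (openConn u v : Set (BondConfig V))} with hK
  set G : Set (BondConfig V) := {ω | s(x, v) ∈ ω} ∩ (F ∩ K) with hG
  -- insensitivity of `G` to `a`
  have hGa : ∀ ω : BondConfig V, ω ∆ {s(u, x)} ∈ G ↔ ω ∈ G := fun ω =>
    inter_insens (fun ω => mem_symmDiff_singleton_of_ne ω hab.symm)
      (inter_insens hFa (apexAvoid_insens u v x (Or.inl rfl))) ω
  have hw0 := apex_hyp_update hw s(u, x) (fun _ => Or.inl (Sym2.mem_mk_left u x)) 0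
  have ha0 : ((Function.update w s(u, x) 0 s(u, x) : unitInterval) : ℝ) = 0 := by simp
  -- decomposition at `a`
  rw [sum_rcWeightW_ind_affine w q s(u, x) G, sum_rcWeightW_update_one_eq_toggle w hq u x G hGa]
  -- the polarised term vanishes: `b ∈ ω` and `K'` force `u ↔ x`
  have hzero : ∑ ω : BondConfig V, rcWeightW (Function.update w s(u, x) 0) q ∅ ω *
      ind (G ∩ (openConn u x : Set (BondConfig V))ᶜ) ω = 0 := by
    refine sum_rcWeightW_ind_eq_zero_ae _ q fun ω hω hmem => ?_
    have hapex := apex_of_rcWeightW_ne_zero _ q hxu hxv hw0 hω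
    obtain ⟨⟨hb, -, hKω⟩, hnot⟩ := hmem
    exact hnot ((reachable_ux_apex_iff hxu hxv hapex).2 (Or.inr ⟨hb, hKω⟩))
  rw [hzero, mul_zero, add_zero]
  -- the pendant step at `b`
  have hFK : ∀ ω : BondConfig V, ω ∆ {s(x, v)} ∈ F ∩ K ↔ ω ∈ F ∩ K :=
    inter_insens hFb (apexAvoid_insens u v x (Or.inr rfl))
  rw [hG, sum_pendant_openPair (Function.update w s(u, x) 0) hq hxu hxv huv hw0 ha0 (F ∩ K) hFK,
    Function.update_of_ne hab.symm]
  ring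

/-- **Apex identity 1**: for `F` insensitive to the apex pairs,
`S_w(F) = ((1 − w a) + (w a)q⁻¹)((1 − w b) + (w b)q⁻¹)·S_{w°}(F) − (w a)(w b)q⁻¹(q⁻¹ − 1)·S_{w°}(F ∩ K')`.
[cite: Grimmett2006, Thm. (3.1)(a) (p. 37); §1.4 eq. (1.20) (p. 15)] -/
theorem apex_mass (w : Sym2 V → unitInterval) {q : ℝ} (hq : q ≠ 0) {u v x : V} (hxu : x ≠ u) (hxv : x ≠ v)
    (huv : u ≠ v) (hw : ∀ e : Sym2 V, x ∈ e → ((w e : unitInterval) : ℝ) ≠ 0 → u ∈ e ∨ v ∈ e)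
    (F : Set (BondConfig V)) (hFa : ∀ ω : BondConfig V, ω ∆ {s(u, x)} ∈ F ↔ ω ∈ F)
    (hFb : ∀ ω : BondConfig V, ω ∆ {s(x, v)} ∈ F ↔ ω ∈ F) :
    ∑ ω : BondConfig V, rcWeightW w q ∅ ω * ind F ω =
      ((1 - ((w s(u, x) : unitInterval) : ℝ)) + ((w s(u, x) : unitInterval) : ℝ) * q⁻¹) *
          ((1 - ((w s(x, v) : unitInterval) : ℝ)) + ((w s(x, v) : unitInterval) : ℝ) * q⁻¹) *
          ∑ ω : BondConfig V, rcWeightW (Function.update (Function.update w s(u, x) 0) s(x, v) 0) q ∅ ω * ind F ω -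
        ((w s(u, x) : unitInterval) : ℝ) * ((w s(x, v) : unitInterval) : ℝ) * q⁻¹ * (q⁻¹ - 1) *
          ∑ ω : BondConfig V, rcWeightW (Function.update (Function.update w s(u, x) 0) s(x, v) 0) q ∅ ω *
            ind (F ∩ {ω : BondConfig V | ω \ {s(u, x), s(x, v)} ∈ (openConn u v : Set (BondConfig V))}) ω := by
  have hab := apex_pairs_ne hxu huv
  set K : Set (BondConfig V) := {ω : BondConfig V | ω \ {s(u, x), s(x, v)} ∈ (openConn u v : Set (BondConfig V))} with hK
  have hw0 := apex_hyp_update hw s(u, x) (fun _ => Or.inl (Sym2.mem_mk_left u x)) 0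
  have ha0 : ((Function.update w s(u, x) 0 s(u, x) : unitInterval) : ℝ) = 0 := by simp
  -- decomposition at `a`
  rw [sum_rcWeightW_ind_affine w q s(u, x) F, sum_rcWeightW_update_one_eq_toggle w hq u x F hFa,
    sum_rcWeightW_ind_inter_compl (Function.update w s(u, x) 0) q F (openConn u x)]
  -- with `a` dead, `u ↔ x` iff `b` open and `K'`
  have hux : ∑ ω : BondConfig V, rcWeightW (Function.update w s(u, x) 0) q ∅ ω *
      ind (F ∩ (openConn u x : Set (BondConfig V))) ω =
      ∑ ω : BondConfig V, rcWeightW (Function.update w s(u, x) 0) q ∅ ω * ind ({ω | s(x, v) ∈ ω} ∩ (F ∩ K)) ω := by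
    refine sum_rcWeightW_ind_congr_ae _ q fun ω hω => ?_
    have hapex := apex_of_rcWeightW_ne_zero _ q hxu hxv hw0 hω
    have ha : s(u, x) ∉ ω := not_mem_of_rcWeightW_ne_zero _ q ha0 hω
    rw [Set.mem_inter_iff, mem_openConn_iff', reachable_ux_apex_iff hxu hxv hapex]
    simp only [ha, false_or, Set.mem_inter_iff, Set.mem_setOf_eq, hK]
    constructor
    · rintro ⟨hF, hb, hk⟩; exact ⟨hb, hF, hk⟩
    · rintro ⟨hb, hF, hk⟩; exact ⟨hF, hb, hk⟩
  have hFK : ∀ ω : BondConfig V, ω ∆ {s(x, v)} ∈ F ∩ K ↔ ω ∈ F ∩ K :=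
    inter_insens hFb (apexAvoid_insens u v x (Or.inr rfl))
  rw [hux, sum_pendant_openPair (Function.update w s(u, x) 0) hq hxu hxv huv hw0 ha0 (F ∩ K) hFK,
    sum_pendant_affine (Function.update w s(u, x) 0) hq hxu hxv huv hw0 ha0 F hFb,
    Function.update_of_ne hab.symm]
  ring

/-- **Apex identity 3**: for `F` insensitive to the apex pairs,
`S_w(J_a ∩ J_b ∩ F) = (w a)(w b)·(q⁻¹·S_{w°}(F) + (q⁻¹ − 1)q⁻¹·S_{w°}(F ∩ K'ᶜ))`.
[cite: Grimmett2006, Thm. (3.1)(a) (p. 37); §1.4 eq. (1.20) (p. 15)] -/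
theorem apex_mass_ab_inter (w : Sym2 V → unitInterval) {q : ℝ} (hq : q ≠ 0) {u v x : V} (hxu : x ≠ u) (hxv : x ≠ v)
    (huv : u ≠ v) (hw : ∀ e : Sym2 V, x ∈ e → ((w e : unitInterval) : ℝ) ≠ 0 → u ∈ e ∨ v ∈ e)
    (F : Set (BondConfig V)) (hFa : ∀ ω : BondConfig V, ω ∆ {s(u, x)} ∈ F ↔ ω ∈ F)
    (hFb : ∀ ω : BondConfig V, ω ∆ {s(x, v)} ∈ F ↔ ω ∈ F) :
    ∑ ω : BondConfig V, rcWeightW w q ∅ ω * ind ({ω | s(u, x) ∈ ω} ∩ ({ω | s(x, v) ∈ ω} ∩ F)) ω =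
      ((w s(u, x) : unitInterval) : ℝ) * ((w s(x, v) : unitInterval) : ℝ) *
        (q⁻¹ * ∑ ω : BondConfig V, rcWeightW (Function.update (Function.update w s(u, x) 0) s(x, v) 0) q ∅ ω * ind F ω +
          (q⁻¹ - 1) * q⁻¹ *
            ∑ ω : BondConfig V, rcWeightW (Function.update (Function.update w s(u, x) 0) s(x, v) 0) q ∅ ω *
              ind (F ∩ {ω : BondConfig V | ω \ {s(u, x), s(x, v)} ∈ (openConn u v : Set (BondConfig V))}ᶜ) ω) := by
  have hab := apex_pairs_ne hxu huv
  set K : Set (BondConfig V) := {ω : BondConfig V | ω \ {s(u, x), s(x, v)} ∈ (openConn u v : Set (BondConfig V))} with hK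
  -- open `a`, then `b`
  rw [sum_rcWeightW_ind_inter_openPair w q s(u, x) ({ω | s(x, v) ∈ ω} ∩ F),
    sum_rcWeightW_ind_inter_openPair (Function.update w s(u, x) 1) q s(x, v) F,
    Function.update_of_ne hab.symm, Function.update_comm hab]
  -- the vector `w[b↦1]` satisfies the apex hypothesis; toggle at `a`
  have hwb := apex_hyp_update hw s(x, v) (fun _ => Or.inr (Sym2.mem_mk_right x v)) 1
  rw [sum_rcWeightW_update_one_eq_toggle (Function.update w s(x, v) 1) hq u x F hFa,
    Function.update_comm hab.symm]
  -- now the base vector is `w[a↦0][b↦1]`; a.s. `b` is open and `a` closed, so `u ↔ x ↔ K'`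
  have hw0 := apex_hyp_update hw s(u, x) (fun _ => Or.inl (Sym2.mem_mk_left u x)) 0
  have hw01 := apex_hyp_update hw0 s(x, v) (fun _ => Or.inr (Sym2.mem_mk_right x v)) 1
  have ha0' : ((Function.update (Function.update w s(u, x) 0) s(x, v) 1 s(u, x) : unitInterval) : ℝ) = 0 := by
    rw [Function.update_of_ne hab]; simp
  have hb1' : ((Function.update (Function.update w s(u, x) 0) s(x, v) 1 s(x, v) : unitInterval) : ℝ) = 1 := by simp
  have hKc : ∑ ω : BondConfig V, rcWeightW (Function.update (Function.update w s(u, x) 0) s(x, v) 1) q ∅ ω *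
      ind (F ∩ (openConn u x : Set (BondConfig V))ᶜ) ω =
      ∑ ω : BondConfig V, rcWeightW (Function.update (Function.update w s(u, x) 0) s(x, v) 1) q ∅ ω * ind (F ∩ Kᶜ) ω := by
    refine sum_rcWeightW_ind_congr_ae _ q fun ω hω => ?_
    have hapex := apex_of_rcWeightW_ne_zero _ q hxu hxv hw01 hω
    have ha : s(u, x) ∉ ω := not_mem_of_rcWeightW_ne_zero _ q ha0' hω
    have hb : s(x, v) ∈ ω := mem_of_rcWeightW_ne_zero _ q hb1' hω
    rw [Set.mem_inter_iff, Set.mem_inter_iff, Set.mem_compl_iff, Set.mem_compl_iff, mem_openConn_iff',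
      reachable_ux_apex_iff hxu hxv hapex]
    simp only [ha, hb, false_or, true_and, hK, Set.mem_setOf_eq]
    exact Iff.rfl
  rw [hKc]
  -- pendant steps on the `a`-dead vector `w[a↦0]`
  have ha0 : ((Function.update w s(u, x) 0 s(u, x) : unitInterval) : ℝ) = 0 := by simp
  have hFKc : ∀ ω : BondConfig V, ω ∆ {s(x, v)} ∈ F ∩ Kᶜ ↔ ω ∈ F ∩ Kᶜ :=
    inter_insens hFb (apexAvoid_compl_insens u v x (Or.inr rfl))
  rw [sum_pendant_update_one (Function.update w s(u, x) 0) hq hxu hxv huv hw0 ha0 F hFb,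
    sum_pendant_update_one (Function.update w s(u, x) 0) hq hxu hxv huv hw0 ha0 (F ∩ Kᶜ) hFKc]
  ring


/-! ### Conversions between measure and mass forms; trivial cases of negative association -/

/-- `S_w(univ) = Z_w`. [cite: Grimmett2006, §1.4 eq. (1.20) (p. 15)] -/
theorem sum_rcWeightW_ind_univ (w : Sym2 V → unitInterval) (q : ℝ) :
    ∑ ω : BondConfig V, rcWeightW w q ∅ ω * ind (Set.univ : Set (BondConfig V)) ω = rcPartitionFunctionW w q ∅ := by
  unfold rcPartitionFunctionW
  refine Finset.sum_congr rfl fun ω _ => ?_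
  rw [ind_of_mem (Set.mem_univ _), mul_one]

/-- Negative association of the pairs `e, f` in measure form iff in mass form: `S(J_e ∩ J_f)·Z ≤ S(J_e)·S(J_f)`.
[cite: Grimmett2006, §3.9 eq. (3.94) (p. 63); §1.4 eq. (1.20) (p. 15)] -/
theorem negCorr_real_iff_mass {q : ℝ} (hq0 : 0 < q) (w : Sym2 V → unitInterval) (e f : Sym2 V) :
    (rcMeasureW w q ∅).real ({ω | e ∈ ω} ∩ {ω | f ∈ ω}) ≤
        (rcMeasureW w q ∅).real {ω | e ∈ ω} * (rcMeasureW w q ∅).real {ω | f ∈ ω} ↔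
      (∑ ω : BondConfig V, rcWeightW w q ∅ ω * ind ({ω | e ∈ ω} ∩ {ω | f ∈ ω}) ω) * rcPartitionFunctionW w q ∅ ≤
        (∑ ω : BondConfig V, rcWeightW w q ∅ ω * ind {ω | e ∈ ω} ω) *
          (∑ ω : BondConfig V, rcWeightW w q ∅ ω * ind {ω | f ∈ ω} ω) := by
  have hZ := rcPartitionFunctionW_pos w hq0 (∅ : Set V)
  rw [rcMeasureW_real_eq_sum_div w hq0 ∅, rcMeasureW_real_eq_sum_div w hq0 ∅, rcMeasureW_real_eq_sum_div w hq0 ∅,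
    div_mul_div_comm, div_le_div_iff₀ hZ (mul_pos hZ hZ)]
  constructor
  · intro h
    refine le_of_mul_le_mul_right ?_ hZ
    calc (∑ ω : BondConfig V, rcWeightW w q ∅ ω * ind ({ω | e ∈ ω} ∩ {ω | f ∈ ω}) ω) * rcPartitionFunctionW w q ∅ *
          rcPartitionFunctionW w q ∅
        = (∑ ω : BondConfig V, rcWeightW w q ∅ ω * ind ({ω | e ∈ ω} ∩ {ω | f ∈ ω}) ω) *
          (rcPartitionFunctionW w q ∅ * rcPartitionFunctionW w q ∅) := by ring
      _ ≤ _ := h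
  · intro h
    calc (∑ ω : BondConfig V, rcWeightW w q ∅ ω * ind ({ω | e ∈ ω} ∩ {ω | f ∈ ω}) ω) *
          (rcPartitionFunctionW w q ∅ * rcPartitionFunctionW w q ∅)
        = (∑ ω : BondConfig V, rcWeightW w q ∅ ω * ind ({ω | e ∈ ω} ∩ {ω | f ∈ ω}) ω) * rcPartitionFunctionW w q ∅ *
          rcPartitionFunctionW w q ∅ := by ring
      _ ≤ _ := mul_le_mul_of_nonneg_right h hZ.le

/-- Negative association is symmetric in the two pairs. [cite: Grimmett2006, §3.9 eq. (3.94) (p. 63)] -/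
theorem negCorr_symm {q : ℝ} (w : Sym2 V → unitInterval) {e f : Sym2 V}
    (h : (rcMeasureW w q ∅).real ({ω | e ∈ ω} ∩ {ω | f ∈ ω}) ≤
      (rcMeasureW w q ∅).real {ω | e ∈ ω} * (rcMeasureW w q ∅).real {ω | f ∈ ω}) :
    (rcMeasureW w q ∅).real ({ω | f ∈ ω} ∩ {ω | e ∈ ω}) ≤
      (rcMeasureW w q ∅).real {ω | f ∈ ω} * (rcMeasureW w q ∅).real {ω | e ∈ ω} := by
  rw [Set.inter_comm, mul_comm]; exact h

/-- A dead pair is negatively associated with everything (the joint event is null).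
[cite: Grimmett2006, §3.9 eq. (3.94) (p. 63); §1.4 eq. (1.20) (p. 15)] -/
theorem negCorr_of_weight_zero_left {q : ℝ} (hq0 : 0 < q) (w : Sym2 V → unitInterval) {e : Sym2 V} (f : Sym2 V)
    (h0 : ((w e : unitInterval) : ℝ) = 0) :
    (rcMeasureW w q ∅).real ({ω | e ∈ ω} ∩ {ω | f ∈ ω}) ≤
      (rcMeasureW w q ∅).real {ω | e ∈ ω} * (rcMeasureW w q ∅).real {ω | f ∈ ω} := by
  rw [rcMeasureW_real_eq_sum_div w hq0 ∅ ({ω | e ∈ ω} ∩ {ω | f ∈ ω}),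
    sum_rcWeightW_ind_inter_openPair_of_zero w q h0 {ω | f ∈ ω}, zero_div]
  exact mul_nonneg measureReal_nonneg measureReal_nonneg

/-- A dead pair is negatively associated with everything (second slot). [cite: Grimmett2006, §3.9 eq. (3.94) (p. 63)] -/
theorem negCorr_of_weight_zero_right {q : ℝ} (hq0 : 0 < q) (w : Sym2 V → unitInterval) (e : Sym2 V) {f : Sym2 V}
    (h0 : ((w f : unitInterval) : ℝ) = 0) :
    (rcMeasureW w q ∅).real ({ω | e ∈ ω} ∩ {ω | f ∈ ω}) ≤
      (rcMeasureW w q ∅).real {ω | e ∈ ω} * (rcMeasureW w q ∅).real {ω | f ∈ ω} :=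
  negCorr_symm w (negCorr_of_weight_zero_left hq0 w e h0)

/-- **Local form of EC⁺ ⇒ negative association** (`0 < q ≤ 1`): if opening `f` does not lower `φ(x ↔ y)` in the state with
`e = s(x,y)` closed, then `J_e` and `J_f` are negatively associated under `φ_w` (the master identity read backwards).
[cite: Grimmett2006, §3.9 eq. (3.94) (p. 63); Thm. (3.1)(a) (p. 37)] -/
theorem negCorr_of_edgeConnMono_at {q : ℝ} (hq0 : 0 < q) (hq1 : q ≤ 1) (w : Sym2 V → unitInterval) {x y : V}
    {f : Sym2 V} (hfe : f ≠ s(x, y))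
    (hEC : (rcMeasureW (Function.update (Function.update w s(x, y) 0) f 0) q ∅).real (openConn x y) ≤
      (rcMeasureW (Function.update (Function.update w s(x, y) 0) f 1) q ∅).real (openConn x y)) :
    (rcMeasureW w q ∅).real ({ω | s(x, y) ∈ ω} ∩ {ω | f ∈ ω}) ≤
      (rcMeasureW w q ∅).real {ω | s(x, y) ∈ ω} * (rcMeasureW w q ∅).real {ω | f ∈ ω} := by
  have hZ := rcPartitionFunctionW_pos w hq0 (∅ : Set V)
  rw [negCorr_real_iff_mass hq0]
  suffices hdef : (∑ ω : BondConfig V, rcWeightW w q ∅ ω * ind ({ω | s(x, y) ∈ ω} ∩ {ω | f ∈ ω}) ω) *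
      rcPartitionFunctionW w q ∅ -
      (∑ ω : BondConfig V, rcWeightW w q ∅ ω * ind {ω | s(x, y) ∈ ω} ω) *
        (∑ ω : BondConfig V, rcWeightW w q ∅ ω * ind {ω | f ∈ ω} ω) ≤ 0 by linarith [hdef]
  rw [negCorr_defect_eq w hq0.ne' x y hfe]
  have hEC' := (edgeConnMono_iff_compl_mass hq0 x y).1 hEC
  have hc0 : 0 ≤ ((w s(x, y) : unitInterval) : ℝ) := (w s(x, y)).2.1
  have hc1 : ((w s(x, y) : unitInterval) : ℝ) ≤ 1 := (w s(x, y)).2.2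
  have hd0 : 0 ≤ ((w f : unitInterval) : ℝ) := (w f).2.1
  have hd1 : ((w f : unitInterval) : ℝ) ≤ 1 := (w f).2.2
  have hr : 0 ≤ q⁻¹ - 1 := by rw [sub_nonneg]; exact (one_le_inv_iff₀.2 ⟨hq0, hq1⟩)
  have hfac : 0 ≤ ((w s(x, y) : unitInterval) : ℝ) * (1 - ((w s(x, y) : unitInterval) : ℝ)) *
      (((w f : unitInterval) : ℝ) * (1 - ((w f : unitInterval) : ℝ))) * (q⁻¹ - 1) := by
    have h1 : 0 ≤ 1 - ((w s(x, y) : unitInterval) : ℝ) := by linarith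
    have h2 : 0 ≤ 1 - ((w f : unitInterval) : ℝ) := by linarith
    positivity
  exact mul_nonpos_iff.2 (Or.inl ⟨hfac, by linarith⟩)

/-- At `q = 1` (product measure) every two pairs are exactly uncorrelated, in particular negatively associated.
[cite: Grimmett2006, §1.4 eq. (1.20) (p. 15); §3.9 eq. (3.94) (p. 63)] -/
theorem negCorr_of_q_one (w : Sym2 V → unitInterval) (e f : Sym2 V) (hfe : f ≠ e) :
    (rcMeasureW w 1 ∅).real ({ω | e ∈ ω} ∩ {ω | f ∈ ω}) ≤
      (rcMeasureW w 1 ∅).real {ω | e ∈ ω} * (rcMeasureW w 1 ∅).real {ω | f ∈ ω} := by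
  induction e using Sym2.ind with
  | h x y =>
  rw [negCorr_real_iff_mass one_pos]
  have hdef := negCorr_defect_eq w one_ne_zero x y hfe
  rw [inv_one, sub_self, mul_zero, zero_mul] at hdef
  linarith [hdef]

/-! ### Supports and updates -/

omit [Fintype V] in
/-- Updating inside the support keeps the support. [folklore] -/
theorem supp_update_mem {w : Sym2 V → unitInterval} {S : Set (Sym2 V)} (hw : ∀ e, ((w e : unitInterval) : ℝ) ≠ 0 → e ∈ S)
    {f : Sym2 V} (hf : f ∈ S) (c : unitInterval) : ∀ e, ((Function.update w f c e : unitInterval) : ℝ) ≠ 0 → e ∈ S := by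
  intro e he
  by_cases hef : e = f
  · exact hef ▸ hf
  · rw [Function.update_of_ne hef] at he; exact hw e he


end FK

end Summit.CriticalPhenomena.PercolationContinuityZ3.Theorems

end
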